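import Literature.AnabelianGeometry.SemiGraphs.PSCCoveringGraphConnected
import Literature.AnabelianGeometry.SemiGraphs.PSCVertCountConnectivityNodal
import Literature.AnabelianGeometry.SemiGraphs.PSCVertCountConnectivityShapes
import HarnessLib

/-!
# The covering semi-graphs `G_U` are connected: the genuine two-component, two-tripod and irreducible-nodal shapes

Mochizuki, *A combinatorial version of the Grothendieck conjecture* [CombGC] §1, Def. 1.1 (i)/(ii) p. 6,
Rmk. 1.1.3 p. 8 [cite: MochizukiCombGC2007, Def 1.1 p.6]; [SemiAnbd] §1 pp. 11–13 (connectedness)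
[cite: MochizukiSemiAnbd2006, §1 pp.11-13].

PROOF-ONLY sequel of `PSCCoveringGraphConnected.lean` (abc-iut-w4-d052, row «COVERING-GRAPH-CONNECTED»):
the Bass–Serre connectedness criterion for abc-iut-L3-t4's covering semi-graphs `G.restrictGraphBD U bd`
instantiated at the three genuine multi-vertex / self-node shapes of the cell's NV programme, with their
GEOMETRIC branch data:

* `exists_branchData_isConnected_of_twoComponent` — TWO-COMPONENT shape (abc-iut-f-165,
  `PSCTwoComponentShape.lean`; handle groups along `ι : Γ_{g₁+g₂,0} → Π`, node group the closure of the
  vanishing cycle): branch data `(v₀, v₁, 1, 1)`; every `G_U` connected;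
* `exists_branchData_isConnected_of_twoTripod` — TWO-TRIPOD shape (abc-iut-L5-t6,
  `PSCTwoTripodOrigin.lean`; sub-basis closures for a free basis `b` of `Γ_{0,4}`): branch data
  `(v₁, v₂, 1, 1)`; every `G_U` connected;
* `exists_branchData_isConnected_of_irreducibleNodal` — IRREDUCIBLE NODAL shape
  (`PSCVertCountConnectivityNodal.lean`; `Π_{v₀} = closure ι(F)`, node groups `closure ι⟨a_g⟩` along
  `ι : Γ_{g+1,0} → Π`): branch data `(v₀, v₀, 1, ι(b_g))` — the two branch embeddings of the self-node,
  the identity and conjugation by the stable letter (abc-iut-L3-t4's loop-faithful `restrictBD` unfolds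
  the loop); every `G_U` connected.

Instance / consistency evidence at genuine data; nothing here takes a side on [IUTchIII] Cor. 3.12.
-/

noncomputable section

namespace Literature.AnabelianGeometry.SemiGraphs

universe u

namespace PSCDatum

open scoped Pointwise
open Literature.GroupTheory.CombinatorialGroupTheory
open SemiGraphOfAnabelioids (IsProSigmaCompletion)

variable {P : Type u} [Group P] [TopologicalSpace P] [IsTopologicalGroup P]

/-! ### Two-component shape -/

section TwoComponent

variable {g₁ g₂ : ℕ}

/-- **Two-component shape: every covering semi-graph is connected** (geometric branch data
`(v₀, v₁, 1, 1)`). [cite: MochizukiCombGC2007, Def 1.1(ii) p.6] -/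
theorem exists_branchData_isConnected_of_twoComponent (G : PSCDatum P) {S : Set ℕ}
    (ι : PuncturedSurfaceGroup (g₁ + g₂) 0 →* P) (hι : IsProSigmaCompletion S ι)
    (v₀ v₁ : G.graph.V) (hV : ∀ w, w = v₀ ∨ w = v₁) (e₀ : G.graph.N)
    (hE : ∀ e, G.graph.nodeEnds e = s(v₀, v₁))
    (hV₀ : G.vertGp v₀ = ((Subgroup.closure
      (Set.range (fun i : Fin g₁ => PuncturedSurfaceGroup.a (r := 0) (Fin.castAdd g₂ i)) ∪
        Set.range (fun i : Fin g₁ => PuncturedSurfaceGroup.b (r := 0) (Fin.castAdd g₂ i)))).map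
          ι).topologicalClosure)
    (hV₁ : G.vertGp v₁ = ((Subgroup.closure
      (Set.range (fun j : Fin g₂ => PuncturedSurfaceGroup.a (r := 0) (Fin.natAdd g₁ j)) ∪
        Set.range (fun j : Fin g₂ => PuncturedSurfaceGroup.b (r := 0) (Fin.natAdd g₁ j)))).map
          ι).topologicalClosure)
    (hN : ∀ e, G.nodeGp e = ((Subgroup.zpowers (List.ofFn fun i : Fin g₁ =>
      PuncturedSurfaceGroup.a (g := g₁ + g₂) (r := 0) (Fin.castAdd g₂ i) *
        PuncturedSurfaceGroup.b (Fin.castAdd g₂ i) * (PuncturedSurfaceGroup.a (Fin.castAdd g₂ i))⁻¹ *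
          (PuncturedSurfaceGroup.b (Fin.castAdd g₂ i))⁻¹).prod).map ι).topologicalClosure) :
    ∃ bd : G.BranchData, (∀ e, bd.fst e = v₀ ∧ bd.snd e = v₁ ∧ bd.conjFst e = 1 ∧ bd.conjSnd e = 1) ∧
      ∀ (U : Subgroup P) [U.FiniteIndex], IsOpen (U : Set P) →
        (G.restrictGraphBD U bd).toSemiGraph.IsConnected := by
  classical
  set z : PuncturedSurfaceGroup (g₁ + g₂) 0 := (List.ofFn fun i : Fin g₁ =>
      PuncturedSurfaceGroup.a (g := g₁ + g₂) (r := 0) (Fin.castAdd g₂ i) *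
        PuncturedSurfaceGroup.b (Fin.castAdd g₂ i) * (PuncturedSurfaceGroup.a (Fin.castAdd g₂ i))⁻¹ *
          (PuncturedSurfaceGroup.b (Fin.castAdd g₂ i))⁻¹).prod with hz
  set z' : PuncturedSurfaceGroup (g₁ + g₂) 0 := (List.ofFn fun j : Fin g₂ =>
      PuncturedSurfaceGroup.a (g := g₁ + g₂) (r := 0) (Fin.natAdd g₁ j) *
        PuncturedSurfaceGroup.b (Fin.natAdd g₁ j) * (PuncturedSurfaceGroup.a (Fin.natAdd g₁ j))⁻¹ *
          (PuncturedSurfaceGroup.b (Fin.natAdd g₁ j))⁻¹).prod with hz'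
  set H₀ : Subgroup (PuncturedSurfaceGroup (g₁ + g₂) 0) := Subgroup.closure
      (Set.range (fun i : Fin g₁ => PuncturedSurfaceGroup.a (g := g₁ + g₂) (r := 0) (Fin.castAdd g₂ i)) ∪
        Set.range (fun i : Fin g₁ => PuncturedSurfaceGroup.b (g := g₁ + g₂) (r := 0) (Fin.castAdd g₂ i)))
    with hH₀
  set H₁ : Subgroup (PuncturedSurfaceGroup (g₁ + g₂) 0) := Subgroup.closure
      (Set.range (fun j : Fin g₂ => PuncturedSurfaceGroup.a (g := g₁ + g₂) (r := 0) (Fin.natAdd g₁ j)) ∪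
        Set.range (fun j : Fin g₂ => PuncturedSurfaceGroup.b (g := g₁ + g₂) (r := 0) (Fin.natAdd g₁ j)))
    with hH₁
  have hprod : ∀ {m : ℕ} (f : Fin m → Fin (g₁ + g₂)) (H : Subgroup (PuncturedSurfaceGroup (g₁ + g₂) 0)),
      (∀ k, PuncturedSurfaceGroup.a (g := g₁ + g₂) (r := 0) (f k) ∈ H) →
      (∀ k, PuncturedSurfaceGroup.b (g := g₁ + g₂) (r := 0) (f k) ∈ H) →
      (List.ofFn fun k : Fin m => PuncturedSurfaceGroup.a (g := g₁ + g₂) (r := 0) (f k) *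
        PuncturedSurfaceGroup.b (f k) * (PuncturedSurfaceGroup.a (f k))⁻¹ *
          (PuncturedSurfaceGroup.b (f k))⁻¹).prod ∈ H := by
    intro m f H ha hb
    refine Subgroup.list_prod_mem _ fun y hy => ?_
    rw [List.mem_ofFn] at hy
    obtain ⟨k, rfl⟩ := hy
    exact H.mul_mem (H.mul_mem (H.mul_mem (ha k) (hb k)) (H.inv_mem (ha k))) (H.inv_mem (hb k))
  have hz₀ : z ∈ H₀ := hprod _ H₀ (fun i => Subgroup.subset_closure (Or.inl ⟨i, rfl⟩))
    (fun i => Subgroup.subset_closure (Or.inr ⟨i, rfl⟩))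
  have hz₁ : z ∈ H₁ := by
    have hrel : z * z' = 1 := PuncturedSurfaceGroup.prod_comm_castAdd_mul_prod_comm_natAdd g₁ g₂
    rw [eq_inv_of_mul_eq_one_left hrel]
    exact H₁.inv_mem (hprod _ H₁ (fun j => Subgroup.subset_closure (Or.inl ⟨j, rfl⟩))
      (fun j => Subgroup.subset_closure (Or.inr ⟨j, rfl⟩)))
  have hle : ∀ (H : Subgroup (PuncturedSurfaceGroup (g₁ + g₂) 0)), z ∈ H →
      ((Subgroup.zpowers z).map ι).topologicalClosure ≤ (H.map ι).topologicalClosure := fun H hzH =>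
    Subgroup.topologicalClosure_mono (Subgroup.map_mono ((Subgroup.zpowers_le).mpr hzH))
  refine G.exists_branchData_restrictGraphBD_isConnected_of_twoVertex v₀ v₁ hV e₀ hE
    (fun e => ⟨by rw [hN e, hV₀]; exact hle H₀ hz₀, by rw [hN e, hV₁]; exact hle H₁ hz₁⟩) ?_
  rw [hV₀, hV₁]
  exact topologicalClosure_sup_eq_top_of_dense ι hι.dense
    (closure_handles_castAdd_sup_closure_handles_natAdd g₁ g₂)

end TwoComponent

/-! ### Two-tripod shape -/

-- adapted from `Literature/GroupTheory/CombinatorialGroupTheory/OneRelatorModPrimeHomologyFaithful.lean`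
/-- A free basis generates. [folklore] -/
private theorem closure_range_basis_eq_top' {ι Γ : Type*} [Group Γ] (b : FreeGroupBasis ι Γ) :
    Subgroup.closure (Set.range b) = ⊤ := by
  rw [eq_top_iff]
  intro x _
  have hx : b.repr x ∈ Subgroup.closure (Set.range (FreeGroup.of : ι → FreeGroup ι)) := by
    rw [FreeGroup.closure_range_of]; exact Subgroup.mem_top _
  have := Subgroup.mem_map_of_mem (b.repr.symm : FreeGroup ι →* Γ) hx
  rw [MonoidHom.map_closure, ← Set.range_comp] at this
  have hrange : ((b.repr.symm : FreeGroup ι →* Γ) ∘ FreeGroup.of) = ⇑b := rfl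
  rw [hrange] at this
  simpa using this

/-- **Two-tripod shape: every covering semi-graph is connected** (geometric branch data
`(v₁, v₂, 1, 1)`). [cite: MochizukiCombGC2007, Def 1.1(ii) p.6] -/
theorem exists_branchData_isConnected_of_twoTripod (G : PSCDatum P) {S : Set ℕ}
    (ι : PuncturedSurfaceGroup 0 4 →* P) (hι : IsProSigmaCompletion S ι)
    (b : FreeGroupBasis (Fin 3) (PuncturedSurfaceGroup 0 4)) (v₁ v₂ : G.graph.V)
    (hV : ∀ v, v = v₁ ∨ v = v₂) (e₀ : G.graph.N) (hE : ∀ e, G.graph.nodeEnds e = s(v₁, v₂))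
    (hV₁ : G.vertGp v₁ = ((Subgroup.closure (b '' {0, 1})).map ι).topologicalClosure)
    (hV₂ : G.vertGp v₂ = ((Subgroup.closure (b '' {1, 2})).map ι).topologicalClosure)
    (hN : ∀ e, G.nodeGp e = ((Subgroup.closure (b '' {1})).map ι).topologicalClosure) :
    ∃ bd : G.BranchData, (∀ e, bd.fst e = v₁ ∧ bd.snd e = v₂ ∧ bd.conjFst e = 1 ∧ bd.conjSnd e = 1) ∧
      ∀ (U : Subgroup P) [U.FiniteIndex], IsOpen (U : Set P) →
        (G.restrictGraphBD U bd).toSemiGraph.IsConnected := by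
  have hle : ∀ S : Set (Fin 3), (1 : Fin 3) ∈ S →
      ((Subgroup.closure (b '' {1})).map ι).topologicalClosure ≤
        ((Subgroup.closure (b '' S)).map ι).topologicalClosure := fun S hS =>
    Subgroup.topologicalClosure_mono (Subgroup.map_mono (Subgroup.closure_mono
      (Set.image_mono (Set.singleton_subset_iff.mpr hS))))
  refine G.exists_branchData_restrictGraphBD_isConnected_of_twoVertex v₁ v₂ hV e₀ hE
    (fun e => ⟨by rw [hN e, hV₁]; exact hle _ (by simp), by rw [hN e, hV₂]; exact hle _ (by simp)⟩) ?_
  rw [hV₁, hV₂]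
  refine topologicalClosure_sup_eq_top_of_dense ι hι.dense ?_
  rw [← Subgroup.closure_union, ← Set.image_union, eq_top_iff, ← closure_range_basis_eq_top' b]
  refine Subgroup.closure_mono ?_
  rintro _ ⟨k, rfl⟩
  refine ⟨k, ?_, rfl⟩
  fin_cases k <;> simp

/-! ### Irreducible nodal shape -/

/-- **Irreducible nodal shape: every covering semi-graph is connected**, for the GEOMETRIC branch data
`(v₀, v₀, 1, ι(b_g))` of the self-node(s) — the identity branch `Π_e ≤ Π_{v₀}` and the branch conjugated
by the stable letter, `ι(b_g) Π_e ι(b_g)⁻¹ ≤ Π_{v₀}`; abc-iut-L3-t4's loop-faithful `restrictGraphBD`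
then unfolds the loop in the coverings. [cite: MochizukiCombGC2007, Def 1.1(ii) p.6] -/
theorem exists_branchData_isConnected_of_irreducibleNodal (G : PSCDatum P) {S : Set ℕ} {g : ℕ}
    (ι : PuncturedSurfaceGroup (g + 1) 0 →* P) (hι : IsProSigmaCompletion S ι)
    (v₀ : G.graph.V) (hV : ∀ w, w = v₀) (e₀ : G.graph.N)
    (hV₀ : G.vertGp v₀ = ((Subgroup.closure
        (Set.range (fun i : Fin g => PuncturedSurfaceGroup.a (g := g + 1) (r := 0) (Fin.castSucc i)) ∪
          Set.range (fun i : Fin g => PuncturedSurfaceGroup.b (g := g + 1) (r := 0) (Fin.castSucc i)) ∪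
          {PuncturedSurfaceGroup.a (g := g + 1) (r := 0) (Fin.last g)})).map ι).topologicalClosure)
    (hN : ∀ e, G.nodeGp e =
      ((Subgroup.zpowers (PuncturedSurfaceGroup.a (g := g + 1) (r := 0) (Fin.last g))).map ι).topologicalClosure) :
    ∃ bd : G.BranchData, (∀ e, bd.fst e = v₀ ∧ bd.snd e = v₀ ∧ bd.conjFst e = 1 ∧
        bd.conjSnd e = ConjAct.toConjAct (ι (PuncturedSurfaceGroup.b (Fin.last g)))) ∧
      ∀ (U : Subgroup P) [U.FiniteIndex], IsOpen (U : Set P) →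
        (G.restrictGraphBD U bd).toSemiGraph.IsConnected := by
  classical
  set t : P := ι (PuncturedSurfaceGroup.b (g := g + 1) (r := 0) (Fin.last g)) with ht
  have hE : ∀ e, G.graph.nodeEnds e = s(v₀, v₀) := by
    intro e
    induction G.graph.nodeEnds e using Sym2.ind with
    | h a b => rw [hV a, hV b]
  have h1 : ∀ e, G.nodeGp e ≤ G.vertGp v₀ := fun e => by
    rw [hN e, hV₀]
    exact Subgroup.topologicalClosure_mono (Subgroup.map_mono ((Subgroup.zpowers_le).mpr
      (Subgroup.subset_closure (Or.inr rfl))))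
  have h2 : ∀ e, ConjAct.toConjAct t • G.nodeGp e ≤ G.vertGp v₀ := by
    intro e x hx
    rw [Subgroup.mem_smul_pointwise_iff_exists] at hx
    obtain ⟨p, hp, rfl⟩ := hx
    rw [ConjAct.smul_def, ConjAct.ofConjAct_toConjAct, hV₀]
    exact conj_nodeGp_le_of_irreducibleNodal ι p ((hN e) ▸ hp)
  let bd : G.BranchData :=
    { fst := fun _ => v₀
      snd := fun _ => v₀
      conjFst := fun _ => 1
      conjSnd := fun _ => ConjAct.toConjAct t
      nodeEnds_eq := hE
      conjFst_smul_le := fun e => by rw [one_smul]; exact h1 e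
      conjSnd_smul_le := h2 }
  refine ⟨bd, fun e => ⟨rfl, rfl, rfl, rfl⟩, fun U _ hU => ?_⟩
  refine G.restrictGraphBD_toSemiGraph_isConnected_of_oneVertex U bd hU v₀ hV ?_
  -- the stable letters are all `t⁻¹`; `⟨Π_{v₀}, t⟩` is dense
  have hrange : (Set.range fun e : G.graph.N =>
      ConjAct.ofConjAct (bd.conjFst e) * (ConjAct.ofConjAct (bd.conjSnd e))⁻¹) = {t⁻¹} := by
    ext x
    simp only [Set.mem_range, Set.mem_singleton_iff]
    constructor
    · rintro ⟨e, rfl⟩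
      simp [bd]
    · rintro rfl
      exact ⟨e₀, by simp [bd]⟩
  rw [hrange, ← Subgroup.zpowers_eq_closure, Subgroup.zpowers_inv, hV₀, ht, ← MonoidHom.map_zpowers]
  have key := topologicalClosure_sup_eq_top_of_dense ι hι.dense (closure_sup_zpowers_last_eq_top g)
  rw [eq_top_iff, ← key]
  refine Subgroup.topologicalClosure_minimal _ (sup_le ?_ ?_) (Subgroup.isClosed_topologicalClosure _)
  · exact le_sup_left.trans (Subgroup.le_topologicalClosure _)
  · exact Subgroup.topologicalClosure_minimal _ (le_sup_right.trans (Subgroup.le_topologicalClosure _))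
      (Subgroup.isClosed_topologicalClosure _)

end PSCDatum

end Literature.AnabelianGeometry.SemiGraphs

end
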